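import Summits.BirchSwinnertonDyer.BirchSwinnertonDyer.Theorems.ResidualThetaTransportAtTwoResidualSignedLambdaLowerCMAtTwoCofreeReductionLimit
import Summits.BirchSwinnertonDyer.BirchSwinnertonDyer.Theorems.ResidualThetaTransportAtTwoResidualSignedLambdaLowerCMAtTwoCofreeLevelwiseKonig
import HarnessLib

/-!
# The Kőnig bookkeeping of the deep half of RSL_g with EVERY bridge discharged: levelwise solution sets in `H¹(ℚ_n, A_ρ[p^k])`
# ⇒ ONE cores-compatible family in `H¹(ℚ_n, T_ρ)` ⇒ ONE element of Kato's `𝐇¹_Γ(T_ρ)` — no LIM_ρ / SEP_ρ / UN_ρ hypothesis left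

Route `ResidualThetaTransportAtTwo` (RTT), crux RSL_g `ResidualSignedLambdaLowerCMAtTwo` (stmt-BirchSwinnertonDyer-22608); seat
`prover-bsd-wall-tp2-p2x` g17 (`--supports 22608 --as helper`, closes nothing). THEOREMS ONLY (no definition, no named fact, no instance,
no `sorry`). Stub plan rev 14/15 Q59 / S56, card `Ideas/stub-cmlambdalower-k3-g10.md` (slot (c) of items 6/7 of `Lines/onepair.lean`):
the width seat's `CofreeLevelwiseKonig.exists_layerFamily_of_levelwise_of_compactSpace` / `…exists_iwasawaH1_of_levelwise` carry LIM_ρ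
(Rubin B.2.3 surjectivity for `T_ρ`) as the hypothesis `hlim`; it is now the THEOREM
`ThetaTransport.exists_forall_reduceH1CofreePkTorsion_eq_of_compatible` (file `…CofreeReductionLimit.lean`, H-C), so here the two
statements are re-issued WITHOUT `hlim`: the only inputs left are the levelwise ARITHMETIC ones the deep-half stubs own — finiteness
(`hfin`, = H-E on the unramified classes), diagonal non-emptiness (`hne`) and `[p]_*` / `Cor`-stability (`hSk` / `hSn`) of the solution
sets `Sol n k ⊆ H¹(ℚ_n, A_ρ[p^k])` — plus `[CompactSpace 𝒪]` (or `[FiniteDimensional ℚ_[p] ℚ_p(S)]`).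

* `exists_layerFamily_of_levelwise` — a `Cor`-compatible `y n ∈ H¹(ℚ_n, T_ρ)` with `red_{p^k} y_n ∈ Sol n k` for all `(n, k)`.
* `exists_iwasawaH1_of_levelwise` — for the cyclotomic `κ` and a pinned `I : IwasawaH1DataCoeff ρ.toGaloisRep p κ γ`, an `x : I.H` with
  `red_{p^k} (I.proj n x) ∈ Sol n k` for all `(n, k)` (integrality by UN_ρ `UniversalNorms.mem_integralH1_of_layerCores_eq_framed`, then
  `I.proj_surjective` — both already inside the width seat's theorem).
* `…_of_finiteDimensional` variants.

References: K. Kato, Astérisque 295 (2004), Lemma 8.5 (2) (p. 183), §12.2 (p. 220), §13.8 (p. 228) [Kato2004Asterisque]; K. Rubin,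
*Euler Systems* (2000), App. B Prop. B.2.3, §B.3 [Rubin2000]. Tree: `…CofreeLevelwiseKonig.lean` (H-A/H-B + glue, width seat w3),
`…CofreeReductionLimit.lean` (H-C), `Literature/…/GreenbergSelmerCofreeReductionSeparated.lean` (H-D),
`Kato2004/UniversalNormsCoeffFramed.lean` (UN_ρ). BSD is not proved by any of this; RSL_g (22608) is not proved here.
-/

set_option autoImplicit false
-- the Theorems namespace of this sub repeats the summit name by design (D-0017 nested layout)
set_option linter.dupNamespace false

noncomputable section

open scoped Classical

namespace Summit.BirchSwinnertonDyer.BirchSwinnertonDyer.Theorems.ThetaTransport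

open CategoryTheory Field
  Literature.NumberTheory.EllipticCurves Literature.NumberTheory.GaloisRepresentations
  Literature.NumberTheory.EllipticCurves.GreenbergSelmer Literature.NumberTheory.EllipticCurves.CyclotomicLayer
  Literature.NumberTheory.EllipticCurves.Kato2004 ZpExtension
  Summit.BirchSwinnertonDyer.BirchSwinnertonDyer.Theorems.CofreeLevelwiseKonig

variable {p : ℕ} [Fact p.Prime] (S : Set (PadicAlgCl p)) {d : ℕ} (ρ : FramedGaloisRep ℚ ↥(padicCoeffIntegers S) d)
  (κ : ZpExtension ℚ p)

/-- **Levelwise solution sets ⇒ ONE cores-compatible family `y n ∈ H¹(ℚ_n, T_ρ)`, all bridges discharged** (`𝒪` compact): finite,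
diagonally non-empty, `[p]_*`/`Cor`-stable `Sol n k ⊆ H¹(ℚ_n, A_ρ[p^k])` ⇒ a `Cor`-compatible `y` with `red_{p^k} y_n ∈ Sol n k` — Kőnig
(`CofreeLevelwiseKonig.exists_layerFamily_of_levelwise_of_compactSpace`) with its LIM_ρ hypothesis supplied by
`exists_forall_reduceH1CofreePkTorsion_eq_of_compatible` (Rubin B.2.3 surjectivity for `T_ρ`).
[cite: Kato2004Asterisque, §12.2 (p. 220), §13.8 (p. 228)] [cite: Rubin2000, App. B Prop. B.2.3 and §B.3] -/
theorem exists_layerFamily_of_levelwise [CompactSpace ↥(padicCoeffIntegers S)]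
    (Sol : ∀ n k : ℕ, Set (H1 (cofreeTorsionGaloisModule S ρ ((p ^ k : ℕ) : ℤ)) (κ.layerSubgroup n)))
    (hfin : ∀ n k, (Sol n k).Finite) (hne : ∀ j, (Sol j j).Nonempty)
    (hSk : ∀ n k, ∀ c ∈ Sol n (k + 1), cohomologyMap (subgroupRepMap (cofreeTorsionPow S ρ k) (κ.layerSubgroup n)) 1 c ∈ Sol n k)
    (hSn : ∀ n k, ∀ c ∈ Sol (n + 1) k, layerCores (cofreeTorsionGaloisModule S ρ ((p ^ k : ℕ) : ℤ)) κ n c ∈ Sol n k) :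
    ∃ y : ∀ n : ℕ, H1 (FramedGaloisRep.toGaloisRep ρ) (κ.layerSubgroup n),
      (∀ n k, (reduceH1CofreePkTorsion S ρ k (κ.layerSubgroup n) (y n) :
          H1 (cofreeTorsionGaloisModule S ρ ((p ^ k : ℕ) : ℤ)) (κ.layerSubgroup n)) ∈ Sol n k) ∧
      ∀ n, layerCores (FramedGaloisRep.toGaloisRep ρ) κ n (y (n + 1)) = y n :=
  exists_layerFamily_of_levelwise_of_compactSpace S ρ κ Sol hfin hne hSk hSn
    fun n c hc ↦ exists_forall_reduceH1CofreePkTorsion_eq_of_compatible S ρ (κ.layerSubgroup n) c hc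

/-- **Levelwise solution sets ⇒ ONE element of Kato's `𝐇¹_Γ(T_ρ)`, all bridges discharged** (the slot-(c) output of items 6/7 of
`Lines/onepair.lean`): for the CYCLOTOMIC `κ`, `𝒪` compact and a pinned datum `I : IwasawaH1DataCoeff ρ.toGaloisRep p κ γ`, finite /
diagonally non-empty / `[p]_*`- and `Cor`-stable solution sets `Sol n k ⊆ H¹(ℚ_n, A_ρ[p^k])` yield `x : I.H` with
`red_{p^k} (I.proj n x) ∈ Sol n k` for all `(n, k)` — Kőnig + LIM_ρ (H-C) + SEP_ρ (H-D) + UN_ρ (Kato Lemma 8.5 (2) for `T_ρ`) +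
`I.proj_surjective`, with NO bridge hypothesis left. [cite: Kato2004Asterisque, Lemma 8.5 (2) (p. 183), §12.2 (p. 220), §13.8 (p. 228)]
[cite: Rubin2000, App. B Prop. B.2.3, B.3.3] -/
theorem exists_iwasawaH1_of_levelwise [CompactSpace ↥(padicCoeffIntegers S)] (hκ : κ.IsCyclotomic)
    {γ : absoluteGaloisGroup ℚ} (I : IwasawaH1DataCoeff (FramedGaloisRep.toGaloisRep ρ) p κ γ)
    (Sol : ∀ n k : ℕ, Set (H1 (cofreeTorsionGaloisModule S ρ ((p ^ k : ℕ) : ℤ)) (κ.layerSubgroup n)))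
    (hfin : ∀ n k, (Sol n k).Finite) (hne : ∀ j, (Sol j j).Nonempty)
    (hSk : ∀ n k, ∀ c ∈ Sol n (k + 1), cohomologyMap (subgroupRepMap (cofreeTorsionPow S ρ k) (κ.layerSubgroup n)) 1 c ∈ Sol n k)
    (hSn : ∀ n k, ∀ c ∈ Sol (n + 1) k, layerCores (cofreeTorsionGaloisModule S ρ ((p ^ k : ℕ) : ℤ)) κ n c ∈ Sol n k) :
    ∃ x : I.H, ∀ n k, (reduceH1CofreePkTorsion S ρ k (κ.layerSubgroup n) (I.proj n x) :
        H1 (cofreeTorsionGaloisModule S ρ ((p ^ k : ℕ) : ℤ)) (κ.layerSubgroup n)) ∈ Sol n k :=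
  CofreeLevelwiseKonig.exists_iwasawaH1_of_levelwise S ρ κ hκ I Sol hfin hne hSk hSn
    fun n c hc ↦ exists_forall_reduceH1CofreePkTorsion_eq_of_compatible S ρ (κ.layerSubgroup n) c hc

/-- `exists_layerFamily_of_levelwise` under the newform habitat's standing hypothesis `[FiniteDimensional ℚ_[p] ℚ_p(S)]`
(`UniversalNorms.compactSpace_padicCoeffIntegers`). [cite: Rubin2000, App. B Prop. B.2.3 and §B.3] -/
theorem exists_layerFamily_of_levelwise_of_finiteDimensional [FiniteDimensional ℚ_[p] ↥(padicCoeffField S)]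
    (Sol : ∀ n k : ℕ, Set (H1 (cofreeTorsionGaloisModule S ρ ((p ^ k : ℕ) : ℤ)) (κ.layerSubgroup n)))
    (hfin : ∀ n k, (Sol n k).Finite) (hne : ∀ j, (Sol j j).Nonempty)
    (hSk : ∀ n k, ∀ c ∈ Sol n (k + 1), cohomologyMap (subgroupRepMap (cofreeTorsionPow S ρ k) (κ.layerSubgroup n)) 1 c ∈ Sol n k)
    (hSn : ∀ n k, ∀ c ∈ Sol (n + 1) k, layerCores (cofreeTorsionGaloisModule S ρ ((p ^ k : ℕ) : ℤ)) κ n c ∈ Sol n k) :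
    ∃ y : ∀ n : ℕ, H1 (FramedGaloisRep.toGaloisRep ρ) (κ.layerSubgroup n),
      (∀ n k, (reduceH1CofreePkTorsion S ρ k (κ.layerSubgroup n) (y n) :
          H1 (cofreeTorsionGaloisModule S ρ ((p ^ k : ℕ) : ℤ)) (κ.layerSubgroup n)) ∈ Sol n k) ∧
      ∀ n, layerCores (FramedGaloisRep.toGaloisRep ρ) κ n (y (n + 1)) = y n :=
  haveI := UniversalNorms.compactSpace_padicCoeffIntegers S
  exists_layerFamily_of_levelwise S ρ κ Sol hfin hne hSk hSn

/-- `exists_iwasawaH1_of_levelwise` under the newform habitat's standing hypothesis `[FiniteDimensional ℚ_[p] ℚ_p(S)]`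
(`UniversalNorms.compactSpace_padicCoeffIntegers`). [cite: Kato2004Asterisque, Lemma 8.5 (2) (p. 183), §12.2 (p. 220)]
[cite: Rubin2000, App. B Prop. B.2.3, B.3.3] -/
theorem exists_iwasawaH1_of_levelwise_of_finiteDimensional [FiniteDimensional ℚ_[p] ↥(padicCoeffField S)] (hκ : κ.IsCyclotomic)
    {γ : absoluteGaloisGroup ℚ} (I : IwasawaH1DataCoeff (FramedGaloisRep.toGaloisRep ρ) p κ γ)
    (Sol : ∀ n k : ℕ, Set (H1 (cofreeTorsionGaloisModule S ρ ((p ^ k : ℕ) : ℤ)) (κ.layerSubgroup n)))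
    (hfin : ∀ n k, (Sol n k).Finite) (hne : ∀ j, (Sol j j).Nonempty)
    (hSk : ∀ n k, ∀ c ∈ Sol n (k + 1), cohomologyMap (subgroupRepMap (cofreeTorsionPow S ρ k) (κ.layerSubgroup n)) 1 c ∈ Sol n k)
    (hSn : ∀ n k, ∀ c ∈ Sol (n + 1) k, layerCores (cofreeTorsionGaloisModule S ρ ((p ^ k : ℕ) : ℤ)) κ n c ∈ Sol n k) :
    ∃ x : I.H, ∀ n k, (reduceH1CofreePkTorsion S ρ k (κ.layerSubgroup n) (I.proj n x) :
        H1 (cofreeTorsionGaloisModule S ρ ((p ^ k : ℕ) : ℤ)) (κ.layerSubgroup n)) ∈ Sol n k :=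
  haveI := UniversalNorms.compactSpace_padicCoeffIntegers S
  exists_iwasawaH1_of_levelwise S ρ κ hκ I Sol hfin hne hSk hSn

end Summit.BirchSwinnertonDyer.BirchSwinnertonDyer.Theorems.ThetaTransport

end
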